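import Summits.Ventures.CertifiedManyBodySolver.Downfold.EmeryBoxesNCCOK26ThermalCapRetiltMarkovBoxp1
import Summits.Ventures.CertifiedManyBodySolver.Downfold.EmeryBoxesNCCOK26ThermalFloorAtlasWord
import Summits.Ventures.CertifiedManyBodySolver.Downfold.EmeryThermalAtomicFloor
import HarnessLib

/-!
# HIGH-TEMPERATURE-CLOSING `T > 0` WINDOW on Nd1.85Ce0.15CuO4 (M20) [#55 x0.10 / #56 Nd2CuO4 x0 share the one-body rows] — U-SLICE «(K) — `emeryBoxNCCOK26` (router/EMERY-FLOOR-ORDERS row 53): the ATOMIC-LIMIT floor (full entropy) ∨ the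
# family floor, against the re-tilted cap — both sides meet at `6 log 2` as β → 0

Venture CertifiedManyBodySolver, cell `pub/hubbard-downfold` (S1 = ROUTER) × crew hubbard-fast S2 (ii) × (iv) «T > 0 × multi-band» (D-0096 (ii)); seat hubbard-downfold-mod-4
(S1/S2 Emery seam, g17). Namespace `Summit.Ventures.CertifiedManyBodySolver.Downfold`. DOOR: `EmeryThermalAtomicFloor` (`holdsOn_emeryCellPressureAtomicFloor`: Peierls on the
whole occupation basis of the `Cu₄O₈` block, site-wise factorisation; the one-site function is the tree's `atomicPartitionFnReal β U μ`). INPUTS BY NAME: the family floor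
`emeryBoxNCCOK26_pressureFloorFam_m8` (`EmeryBoxesNCCOK26ThermalFloorAtlasWord`; C = (-116.055914, -117.202308)), the cap `emeryBoxNCCOK26_pressureCap_m8_retilt` (`EmeryBoxesNCCOK26ThermalCapRetiltMarkovBoxp1`; `6 log 2 + 36.2175·β`; flat word 42.2175).
ATOMIC DATA: Cu at `μ_d = −(εp + Δ_hi) = 11/2`, `U_d,hi = 5287/1000`; O at `μ_p = −εp = 8`, `U_p,hi = 2249/500` ⇒ classical slope 28.7170·β (family slope 29.3006; cap 36.2175).
RESULT: **`emeryBoxNCCOK26_pressureWindowHighT_m8`**: `max(atomic, family) ≤ P_cell ≤ 6 log 2 + 36.2175·β` on the whole box, every β ≥ 0; width → 0 as β → 0 (both sides `6 log 2`,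
`emeryBoxNCCOK26_pressure_beta_zero_m8`); crossover β* ≈ 1.502 (T* ≈ 7725 K) below which the atomic floor is the better floor [float].

Everything PROVED (0 sorry); no definition. HONEST FRAMING: CERTIFIED inequalities on a SCREENING/EXTRAPOLATED-grade object; the atomic floor ignores hopping (its slope sits
0.5836 below the family floor's), so at physical temperatures (β ≈ 20–40 eV⁻¹) the family floor still decides and thermal scales are NOT resolved there; what is new
is the correct INFINITE-TEMPERATURE closure of the window and a certified high-T regime (β ≲ β*) with width `≈ 7.5005·β`; grand-canonical at the stated level; no phase word;
no router number moves. WHAT-THIS-IS-NOT: a new certificate (pure algebra on landed objects; zero kit).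
-/

noncomputable section

namespace Summit.Ventures.CertifiedManyBodySolver.Downfold

open NonemptyInterval Matrix Finset Literature.Probability.LatticeModels
open Literature.MathematicalPhysics.QuantumLattice Literature.Computation.Certificates
open Summit.Ventures.CertifiedManyBodySolver.Certificates OccupationCode ClusterLowerBound
open scoped BigOperators ComplexOrder

/-! ## §1 The atomic-limit floor on the box at εp = -8 -/

/-- **ATOMIC-LIMIT `T > 0` FLOOR** on the whole `emeryBoxNCCOK26`, cuprate signs, level εp = -8 (chemical potential 8 eV), EVERY β ≥ 0:
`log z₀(β; U_d = 5287/1000, μ_d = 11/2) + 2·log z₀(β; U_p = 2249/500, μ_p = 8) ≤ P_cell` with `z₀(β; U, μ) = 1 + 2e^{βμ} + e^{−β(U−2μ)}` (`atomicPartitionFnReal`; Cu at the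
box's upper level `εp + Δ_hi = -11/2` and `U_d,hi`, O at `εp` and `U_p,hi`). Value `6 log 2` at β = 0; slope `28.7170·β` as β → ∞ (classical minimum, no hopping).
[cite: Ruelle1969, §2.5–2.6] [cite: Ueltschi1999, §3] -/
theorem emeryBoxNCCOK26_pressureAtomicFloor_m8 {β : ℝ} (hβ : 0 ≤ β) :
    HoldsOn (fun p : EmeryCoord → ℝ => Real.log (atomicPartitionFnReal β (5287/1000 : ℝ) (11/2 : ℝ)) + 2 * Real.log (atomicPartitionFnReal β (2249/500 : ℝ) (8 : ℝ)) ≤ emeryCellPressure β (emeryLine cuprateSigns (emeryLineCoords (((-8 : ℚ)) : ℝ) p))) emeryBoxNCCOK26 := by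
  intro p hp
  have h := holdsOn_emeryCellPressureAtomicFloor (E := emeryBoxNCCOK26) (eA := nccoK26Emery_tpd) (eB := nccoK26Emery_tpp) (eD := nccoK26Emery_Delta) (eUd := nccoK26Emery_Udd) (eUp := nccoK26Emery_Upp) (-8) (by simp [emeryBoxNCCOK26, emeryBoxNCCOK26Src, Function.update]) (by simp [emeryBoxNCCOK26, emeryBoxNCCOK26Src, Function.update]) (Function.update_self _ _ _) (by simp [emeryBoxNCCOK26, emeryBoxNCCOK26Src, Function.update]) (by simp [emeryBoxNCCOK26, emeryBoxNCCOK26Src, Function.update]) cuprateSigns hβ p hp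
  simp only [nccoK26Emery_Delta, nccoK26Emery_Udd, nccoK26Emery_Upp, Entry.encl_ofEnds_snd] at h
  push_cast at h
  norm_num at h ⊢
  exact h

/-! ## §2 The best floor and the HIGH-TEMPERATURE-CLOSING window -/

/-- **BEST `T > 0` FLOOR = max(atomic, family)** on the whole box at εp = -8, every β ≥ 0: the atomic floor (full entropy, slope 28.7170) wins for
β < β* ≈ 1.502 (T > 7725 K), the family floor `emeryBoxNCCOK26_pressureFloorFam_m8` (slope 29.3006, entropy ¼·log 2) for β > β*. [cite: Ruelle1969, §2.5–2.6] [cite: Israel1979, Lemma II.3.1] -/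
theorem emeryBoxNCCOK26_pressureFloorBest_m8 {β : ℝ} (hβ : 0 ≤ β) :
    HoldsOn (fun p : EmeryCoord → ℝ => max (Real.log (atomicPartitionFnReal β (5287/1000 : ℝ) (11/2 : ℝ)) + 2 * Real.log (atomicPartitionFnReal β (2249/500 : ℝ) (8 : ℝ))) (Real.log (Real.exp (-(β * (-58027957/500000 : ℝ))) + Real.exp (-(β * (-29300577/250000 : ℝ)))) / 4) ≤ emeryCellPressure β (emeryLine cuprateSigns (emeryLineCoords (((-8 : ℚ)) : ℝ) p))) emeryBoxNCCOK26 :=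
  fun p hp => max_le (emeryBoxNCCOK26_pressureAtomicFloor_m8 hβ p hp) (emeryBoxNCCOK26_pressureFloorFam_m8 hβ p hp)

/-- **THE HIGH-TEMPERATURE-CLOSING TWO-SIDED `T > 0` WINDOW** (hypothesis-free on both sides) on the whole `emeryBoxNCCOK26`, level εp = -8, EVERY β ≥ 0:
`max(atomic, family) ≤ P_cell ≤ 6 log 2 + β·2897403/80000` (cap = `emeryBoxNCCOK26_pressureCap_m8_retilt`, hubbard-box-p1 re-tilted). BOTH SIDES EQUAL `6 log 2` AT β = 0; the width is `O(β)` for small β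
(slope gap 7.5005 against the atomic floor, 6.9170 against the family floor). Table [float; `T = 11604.5/β` K]:
| β (1/eV) | T (K) | atomic floor | family floor | best floor | cap | width |
|---|---|---|---|---|---|---|
| 0.01 | 1160450 | 4.3402 | 0.4649 | 4.3402 | 4.5211 | 0.1808 |
| 0.1 | 116045 | 6.1363 | 3.0894 | 6.1363 | 7.7806 | 1.6443 |
| 0.5 | 23209 | 16.0085 | 14.7621 | 16.0085 | 22.2677 | 6.2592 |
| 1 | 11604 | 29.7971 | 29.3696 | 29.7971 | 40.3764 | 10.5793 |
| 2 | 5802 | 58.2732 | 58.6252 | 58.6252 | 76.5940 | 17.9688 |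
| 5 | 2321 | 144.1094 | 146.5037 | 146.5037 | 185.2466 | 38.7429 |
| 10 | 1160 | 287.3832 | 293.0058 | 293.0058 | 366.3343 | 73.3285 |
| 20 | 580 | 574.3679 | 586.0115 | 586.0115 | 728.5096 | 142.4981 |
| 40 | 290 | 1148.6804 | 1172.0231 | 1172.0231 | 1452.8604 | 280.8373 |
[cite: Israel1979, Thm. I.2.4] [cite: Ruelle1969, §2.5–2.6] [cite: Ueltschi1999, §3] -/
theorem emeryBoxNCCOK26_pressureWindowHighT_m8 {β : ℝ} (hβ : 0 ≤ β) :
    HoldsOn (fun p : EmeryCoord → ℝ =>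
      max (Real.log (atomicPartitionFnReal β (5287/1000 : ℝ) (11/2 : ℝ)) + 2 * Real.log (atomicPartitionFnReal β (2249/500 : ℝ) (8 : ℝ))) (Real.log (Real.exp (-(β * (-58027957/500000 : ℝ))) + Real.exp (-(β * (-29300577/250000 : ℝ)))) / 4) ≤ emeryCellPressure β (emeryLine cuprateSigns (emeryLineCoords (((-8 : ℚ)) : ℝ) p)) ∧
      emeryCellPressure β (emeryLine cuprateSigns (emeryLineCoords (((-8 : ℚ)) : ℝ) p)) ≤ 6 * Real.log 2 + β * (2897403/80000 : ℝ)) emeryBoxNCCOK26 :=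
  fun p hp => ⟨emeryBoxNCCOK26_pressureFloorBest_m8 hβ p hp, by simpa using emeryBoxNCCOK26_pressureCap_m8_retilt hβ p hp⟩

/-- **At β = 0 the window is a point**: `P_cell(0, ·) = 6 log 2` on the whole box (floor and cap coincide). [cite: Ueltschi1999, §3] -/
theorem emeryBoxNCCOK26_pressure_beta_zero_m8 :
    HoldsOn (fun p : EmeryCoord → ℝ => emeryCellPressure 0 (emeryLine cuprateSigns (emeryLineCoords (((-8 : ℚ)) : ℝ) p)) = 6 * Real.log 2) emeryBoxNCCOK26 := by
  intro p hp
  have h := emeryBoxNCCOK26_pressureWindowHighT_m8 le_rfl p hp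
  rw [atomicPartitionFnReal_beta_zero, atomicPartitionFnReal_beta_zero, show (4 : ℝ) = 2 ^ 2 by norm_num, Real.log_pow] at h
  simp only [Nat.cast_ofNat, zero_mul, add_zero] at h
  have h1 := (le_max_left _ _).trans h.1
  linarith [h.2]

end Summit.Ventures.CertifiedManyBodySolver.Downfold

end
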